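import Literature.Analysis.FluidPDE.Seregin2019LocalWeakL3
import Literature.Analysis.FluidPDE.Seregin2019BlowupContradiction
import Literature.Analysis.FluidPDE.Seregin2019TopPairingModulus
import Literature.Analysis.FluidPDE.Seregin2019ZoomData
import Literature.Analysis.FluidPDE.Seregin2019CubicNonSmallness
import HarnessLib

/-!
# Seregin 2019, Proposition 1.4: local ε-regularity in weak `L³` — the discharge

Analysis/FluidPDE proofs-only file (theorems only: no definitions, no named facts, no `sorry`):
the proof of the named fact `Literature.Analysis.FluidPDE.seregin2019_localWeakL3_epsRegularity`
(`Seregin2019LocalWeakL3.lean`; G. Seregin, *St. Petersburg Math. J.* 32 (2021) 565–576 =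
arXiv:1906.06707, Prop. 1.4), as `seregin2019_localWeakL3_epsRegularity_holds`.

The printed proof (§4, of Prop. 1.3, and Prop. 1.4 by scaling) argues ad absurdum: a sequence
of violators with `ε_k → 0` is bounded in the scale-invariant norms ((scale inv.), (4.5)), is
non-small in the cubic functional at all scales above the unbounded cylinder (Prop. 4.1, (4.4)),
and after rescaling converges to a suitable weak solution on `]-a², 0[ × B(a)` for all `a`, whose
slices are weak-`L³`, whose top slice vanishes (sparse top slices + weak continuity in time) and
which is non-trivial — contradicting the Liouville-type theorem proved by the local-Leray restart
and backward uniqueness (§4 pp. 7–8, [ESS2003], [LR]). The tree carries each step as a theorem: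

* negation bookkeeping with `ε_k = 16^{-(k+1)}` and ONE rescaling per violator by
  `λ_k = ε_k^{1/4} r_k = 2^{-(k+1)} r_k` (this replaces the two successive blow-ups of the print,
  "`r_k → r_* = 0` or `r_* > 0`" and "`ρ_k → 0`": with this choice the top-slice threshold
  `λ_k ε_k / r_k = ε_k^{5/4} → 0`, its mass `ε_k r_k³/λ_k³ = ε_k^{1/4} → 0` on `B(ε_k^{-1/4}) ↑ ℝ³`,
  and the non-smallness scale `λ_k ≥ ε_k r_k/ϑ` eventually) — this file;
* the data of one rescaled violator — `Seregin2019ZoomData.lean`, `Seregin2019TopPairingModulus.lean`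
  (weak equicontinuity in time, Temam Ch. III §3, for (4.9)–(4.10)), `Seregin2019TopSlicePairing.lean`;
* (scale inv.) — `Seregin2019ScaleInvariantBounds.lean`; Prop. 4.1/(4.4) —
  `Seregin2019CubicNonSmallness.lean`;
* compactness, limit, Liouville — `Seregin2019.false_of_blowupSequence`
  (`Seregin2019BlowupContradiction.lean`, on `LocalTypeIBlowup.local_suitableCompactness`,
  `Seregin2019LimitSlices/LimitBounds.lean`, `Seregin2019WeakL3AncientLiouville.lean`).

## References

* G. Seregin, *A note on weak solutions to the Navier–Stokes equations that are locally in
  `L_∞(L^{3,∞})`*, arXiv:1906.06707 (2019), Prop. 1.3/1.4 and §4. [`Seregin2019`]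
* L. Escauriaza, G. Seregin, V. Šverák, Russian Math. Surveys 58 (2003). [ESS2003]
-/

noncomputable section

open MeasureTheory Set Function Filter Topology TopologicalSpace Metric
open scoped NNReal ENNReal InnerProductSpace RealInnerProductSpace

namespace Literature.Analysis.FluidPDE

namespace Seregin2019

/-- **Seregin 2019, §4: a sequence of violators of Prop. 1.4 with `ε_k = δ_k⁴`, `δ_k = 2^{-(k+1)}`,
is contradictory.** For every `k` let `(u_k, p_k)` be a suitable weak solution in `Q(z₀ᵏ, R_k)`
with a weak gradient `G_k`, `D₀ + E ≤ N`, weak-`L³` slices of level `M`, slices weakly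
left-continuous at the top time, a radius `0 < r_k ≤ R_k/2` with the sparse top slice
`|{x ∈ B(x₀ᵏ, r_k) : δ_k⁴/r_k < |u_k(t₀ᵏ, x)|}| ≤ δ_k⁴ r_k³`, and `u_k ∉ L^∞(Q(z₀ᵏ, δ_k⁴ r_k))`.
Then `False`: the rescaled pairs `λ_k u_k(t₀ᵏ + λ_k² s, x₀ᵏ + λ_k y)`, `λ_k = δ_k r_k` (pressure
gauged by its `B(x₀ᵏ,R_k)`-mean and rescaled with `λ_k²`) satisfy the hypotheses of
`false_of_blowupSequence`. [cite: Seregin2019, §4, proof of Prop. 1.3 (arXiv:1906.06707 pp. 7–8)] -/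
theorem false_of_violators {M N : ℝ} {δ : ℕ → ℝ} (hδ : ∀ k, δ k = (1 / 2 : ℝ) ^ (k + 1))
    {z₀ : ℕ → ℝ × EuclideanSpace ℝ (Fin 3)} {R r : ℕ → ℝ}
    {u : ℕ → ℝ → EuclideanSpace ℝ (Fin 3) → EuclideanSpace ℝ (Fin 3)}
    {p : ℕ → ℝ → EuclideanSpace ℝ (Fin 3) → ℝ}
    {G : ℕ → ℝ → EuclideanSpace ℝ (Fin 3) → EuclideanSpace ℝ (Fin 3) →L[ℝ] EuclideanSpace ℝ (Fin 3)}
    (hR : ∀ k, 0 < R k) (hball : ∀ k, IsSuitableWeakSolutionInBall (R k) (z₀ k) (u k) (p k))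
    (hG : ∀ k, HasWeakSpatialGradientOn (parabolicCylinderOpens (R k) (z₀ k)) (u k) (G k))
    (hN : ∀ k, cknDOsc (R k) (z₀ k) (p k) + cknE (R k) (z₀ k) (G k) ≤ ENNReal.ofReal N)
    (hsl : ∀ k, ∀ t ∈ Ioo ((z₀ k).1 - R k ^ 2) (z₀ k).1, ∀ α : ℝ, 0 < α →
      ENNReal.ofReal (α ^ 3) *
          (volume.restrict (ball (z₀ k).2 (R k))) {x : EuclideanSpace ℝ (Fin 3) | α < ‖u k t x‖} ≤
        ENNReal.ofReal (M ^ 3))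
    (hcont : ∀ k, ∀ w : EuclideanSpace ℝ (Fin 3) → EuclideanSpace ℝ (Fin 3), MemLp w 2 volume →
      support w ⊆ ball (z₀ k).2 (R k) →
      Tendsto (fun t => ∫ x, ⟪u k t x, w x⟫) (𝓝[<] (z₀ k).1) (𝓝 (∫ x, ⟪u k (z₀ k).1 x, w x⟫)))
    (hr : ∀ k, 0 < r k) (hrR : ∀ k, r k ≤ R k / 2)
    (hsp : ∀ k, (volume.restrict (ball (z₀ k).2 (r k)))
        {x : EuclideanSpace ℝ (Fin 3) | δ k ^ 4 / r k < ‖u k (z₀ k).1 x‖} ≤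
      ENNReal.ofReal (δ k ^ 4 * r k ^ 3))
    (hunb : ∀ k, eLpNorm (uncurry (u k)) ∞
      (volume.restrict (parabolicCylinder (δ k ^ 4 * r k) (z₀ k))) = ∞) : False := by
  -- ## the scales `δ_k = 2^{-(k+1)}`, `λ_k = δ_k r_k`
  have hδpos : ∀ k, 0 < δ k := fun k => by rw [hδ]; positivity
  have hδle : ∀ k, δ k ≤ 1 / 2 := fun k => by
    rw [hδ]
    calc (1 / 2 : ℝ) ^ (k + 1) ≤ (1 / 2 : ℝ) ^ 1 :=
          pow_le_pow_of_le_one (by norm_num) (by norm_num) (by omega)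
      _ = 1 / 2 := pow_one _
  have hδ1 : ∀ k, δ k ≤ 1 := fun k => (hδle k).trans (by norm_num)
  have hδlim : Tendsto δ atTop (𝓝 0) := by
    rw [show δ = fun k => (1 / 2 : ℝ) ^ (k + 1) from funext hδ]
    exact (tendsto_pow_atTop_nhds_zero_of_lt_one (by norm_num) (by norm_num)).comp
      (tendsto_add_atTop_nat 1)
  have hδdy : ∀ m k : ℕ, m ≤ k → (2 : ℝ) ^ m * δ k ≤ 1 / 2 := by
    intro m k hmk
    rw [hδ, one_div_pow, mul_one_div, div_le_iff₀ (by positivity), pow_succ]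
    have : (2 : ℝ) ^ m ≤ 2 ^ k := pow_le_pow_right₀ (by norm_num) hmk
    linarith
  have hev : ∀ c : ℝ, ∀ᶠ k in atTop, δ k * c ≤ 1 / 2 := by
    intro c
    have h : Tendsto (fun k => δ k * c) atTop (𝓝 0) := by simpa using hδlim.mul_const c
    exact h.eventually_le_const (by norm_num)
  have hevle : ∀ c : ℝ, 0 < c → ∀ᶠ k in atTop, δ k ≤ c := fun c hc => hδlim.eventually_le_const hc
  obtain ⟨lam, hlamdef⟩ : ∃ lam : ℕ → ℝ, ∀ k, lam k = δ k * r k := ⟨_, fun k => rfl⟩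
  have hlam : ∀ k, 0 < lam k := fun k => by rw [hlamdef]; exact mul_pos (hδpos k) (hr k)
  have hlamR : ∀ k, lam k ≤ δ k * R k / 2 := fun k => by
    rw [hlamdef]; nlinarith [hrR k, hδpos k]
  have hlam4 : ∀ k, lam k ≤ R k / 4 := fun k => by nlinarith [hlamR k, hδle k, hR k, hδpos k]
  have hrl : ∀ k, r k / lam k = 1 / δ k := fun k => by
    rw [hlamdef, div_eq_iff (mul_ne_zero (hδpos k).ne' (hr k).ne'), one_div_mul_eq_div,
      mul_div_cancel_left₀ _ (hδpos k).ne']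
  have hRl : ∀ k, 2 / δ k ≤ R k / lam k := fun k => by
    rw [div_le_div_iff₀ (hδpos k) (hlam k), hlamdef]
    nlinarith [hrR k, hδpos k]
  have hpow : ∀ m k : ℕ, m ≤ k → (2 : ℝ) ^ m ≤ R k / lam k := by
    intro m k hmk
    have h1 : (2 : ℝ) ^ m ≤ 2 / δ k := by
      rw [le_div_iff₀ (hδpos k)]; nlinarith [hδdy m k hmk]
    exact h1.trans (hRl k)
  -- ## the gauged pressures, a weak gradient, the scale-invariant bounds (4.5)
  obtain ⟨pt, hpt⟩ : ∃ pt : ℕ → ℝ → EuclideanSpace ℝ (Fin 3) → ℝ,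
      ∀ k, pt k = fun t x => p k t x - ⨍ y in ball (z₀ k).2 (R k), p k t y := ⟨_, fun k => rfl⟩
  have hballt : ∀ k, IsSuitableWeakSolutionInBall (R k) (z₀ k) (u k) (pt k) := fun k => by
    rw [hpt]; exact isSuitableWeakSolutionInBall_sub_ballMean (hR k) (hball k)
  obtain ⟨K, hK⟩ := exists_scaledEnergies_bound M N
  have hΘ : ∀ k, ∀ z : ℝ × EuclideanSpace ℝ (Fin 3),
      parabolicCylinder (R k / 2) z ⊆ parabolicCylinder (R k) (z₀ k) →
      ∀ ρ ∈ Ioc (0 : ℝ) (R k / 4),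
        cknAEss ρ z (u k) ≤ K ∧ cknE ρ z (G k) ≤ K ∧ cknC ρ z (u k) ≤ K ∧ cknD ρ z (pt k) ≤ K := by
    intro k z hz ρ hρ
    rw [hpt]
    exact hK (z₀ k) (R k) (u k) (p k) (G k) (hR k) (hball k) (hG k) (hN k) (hsl k) z hz ρ hρ
  have hself : ∀ k, parabolicCylinder (R k / 2) (z₀ k) ⊆ parabolicCylinder (R k) (z₀ k) :=
    fun k => parabolicCylinder_mono (half_pos (hR k)).le (half_le_self (hR k).le) _
  have hC0 : ∀ k, ∀ ρ ∈ Ioc (0 : ℝ) (R k / 4), cknC ρ (z₀ k) (u k) ≤ K :=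
    fun k ρ hρ => (hΘ k _ (hself k) ρ hρ).2.2.1
  have hD0 : ∀ k, ∀ ρ ∈ Ioc (0 : ℝ) (R k / 4), cknD ρ (z₀ k) (pt k) ≤ K :=
    fun k ρ hρ => (hΘ k _ (hself k) ρ hρ).2.2.2
  -- ## the rescaled pairs `u^k(s,y) = λ_k u_k(t₀ + λ_k² s, x₀ + λ_k y)`, `p^k = λ_k² p̃_k(…)`
  obtain ⟨v, hv⟩ : ∃ v : ℕ → ℝ → EuclideanSpace ℝ (Fin 3) → EuclideanSpace ℝ (Fin 3),
      ∀ k, v k = lam k • stPull (lam k ^ 2) (lam k) (z₀ k).1 (z₀ k).2 (u k) := ⟨_, fun k => rfl⟩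
  obtain ⟨q, hq⟩ : ∃ q : ℕ → ℝ → EuclideanSpace ℝ (Fin 3) → ℝ,
      ∀ k, q k = lam k ^ 2 • stPull (lam k ^ 2) (lam k) (z₀ k).1 (z₀ k).2 (pt k) := ⟨_, fun k => rfl⟩
  have hballL : ∀ k, IsSuitableWeakSolutionInBall (R k / lam k) (0 : ℝ × EuclideanSpace ℝ (Fin 3))
      (v k) (q k) := fun k => by
    rw [hv, hq]; exact (hballt k).zoom_radius (hlam k)
  -- (i) the class on `Q(2ᵐ)`, `m ≤ k`
  have hball' : ∀ m k : ℕ, m ≤ k →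
      IsSuitableWeakSolutionInBall ((2 : ℝ) ^ m) (0 : ℝ × EuclideanSpace ℝ (Fin 3)) (v k) (q k) :=
    fun m k hmk => SuitableCompactness.isSuitableWeakSolutionInBall_of_le_radius (hballL k)
      (pow_pos two_pos m) (hpow m k hmk)
  -- (ii) the levels (4.5)
  have hbd' : ∀ m : ℕ, (⨆ k, ⨆ (_ : m ≤ k), (eLpNorm (uncurry (v k)) 3
        (volume.restrict (parabolicCylinder ((2 : ℝ) ^ m) (0 : ℝ × EuclideanSpace ℝ (Fin 3)))) +
      eLpNorm (uncurry (q k)) (3 / 2)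
        (volume.restrict (parabolicCylinder ((2 : ℝ) ^ m) (0 : ℝ × EuclideanSpace ℝ (Fin 3)))))) < ∞ := by
    intro m
    have h2m : (0 : ℝ) < 2 ^ m := pow_pos two_pos m
    have hfin : ENNReal.ofReal ((2 : ℝ) ^ m) ^ 2 * (K : ℝ≥0∞) ≠ ∞ :=
      ENNReal.mul_ne_top (ENNReal.pow_ne_top ENNReal.ofReal_ne_top) ENNReal.coe_ne_top
    refine lt_of_le_of_lt (iSup_le fun k => iSup_le fun hmk => ?_)
      (show (ENNReal.ofReal ((2 : ℝ) ^ m) ^ 2 * (K : ℝ≥0∞)) ^ (1 / 3 : ℝ) +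
          (ENNReal.ofReal ((2 : ℝ) ^ m) ^ 2 * (K : ℝ≥0∞)) ^ (2 / 3 : ℝ) < ∞ from
        ENNReal.add_lt_top.2 ⟨ENNReal.rpow_lt_top_of_nonneg (by norm_num) hfin,
          ENNReal.rpow_lt_top_of_nonneg (by norm_num) hfin⟩)
    rw [hv, hq]
    refine eLpNorm_zoom_levels_le (hlam k) (hC0 k) (hD0 k) h2m ?_
    have hRk := hR k
    calc lam k * 2 ^ m ≤ δ k * R k / 2 * 2 ^ m := by gcongr; exact hlamR k
      _ = R k * (2 ^ m * δ k) / 2 := by ring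
      _ ≤ R k * (1 / 2) / 2 := by gcongr; exact hδdy m k hmk
      _ = R k / 4 := by ring
  -- (iii) the scaled energies at shifted apices, eventually
  have hgood : ∀ z : ℝ × EuclideanSpace ℝ (Fin 3), z.1 ≤ 0 → ∀ ϱ : ℝ, 0 < ϱ → ∀ᶠ k in atTop,
      parabolicCylinder (R k / 2) (stAffine (lam k ^ 2) (lam k) (z₀ k).1 (z₀ k).2 z) ⊆
          parabolicCylinder (R k) (z₀ k) ∧ lam k * ϱ ∈ Ioc (0 : ℝ) (R k / 4) := by
    intro z hz ϱ hϱ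
    filter_upwards [hev |z.1|, hev ‖z.2‖, hev ϱ] with k h1 h2 h3
    have hRk := hR k
    have hlk := hlam k
    have hlR := hlamR k
    have hδk := hδpos k
    have hδ1k := hδ1 k
    refine ⟨zoom_apex_subset (hlam k) hz ?_ ?_, mul_pos hlk hϱ, ?_⟩
    · calc lam k ^ 2 * |z.1| ≤ (δ k * R k / 2) ^ 2 * |z.1| := by gcongr
        _ = R k ^ 2 * δ k * (δ k * |z.1|) / 4 := by ring
        _ ≤ R k ^ 2 * 1 * (1 / 2) / 4 := by gcongr
        _ ≤ 3 * R k ^ 2 / 4 := by nlinarith [sq_nonneg (R k)]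
    · calc lam k * ‖z.2‖ ≤ δ k * R k / 2 * ‖z.2‖ := by gcongr
        _ = R k * (δ k * ‖z.2‖) / 2 := by ring
        _ ≤ R k * (1 / 2) / 2 := by gcongr
        _ ≤ R k / 2 := by linarith
    · calc lam k * ϱ ≤ δ k * R k / 2 * ϱ := by gcongr
        _ = R k * (δ k * ϱ) / 2 := by ring
        _ ≤ R k * (1 / 2) / 2 := by gcongr
        _ = R k / 4 := by ring
  have hC' : ∀ z : ℝ × EuclideanSpace ℝ (Fin 3), z.1 ≤ 0 → ∀ ϱ : ℝ, 0 < ϱ →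
      ∀ᶠ k in atTop, cknC ϱ z (v k) ≤ K := by
    intro z hz ϱ hϱ
    filter_upwards [hgood z hz ϱ hϱ] with k hk
    rw [hv, cknC_zoom (hlam k) hϱ]
    exact (hΘ k _ hk.1 _ hk.2).2.2.1
  have hD' : ∀ z : ℝ × EuclideanSpace ℝ (Fin 3), z.1 ≤ 0 → ∀ ϱ : ℝ, 0 < ϱ →
      ∀ᶠ k in atTop, cknD ϱ z (q k) ≤ K := by
    intro z hz ϱ hϱ
    filter_upwards [hgood z hz ϱ hϱ] with k hk
    rw [hq, cknD_zoom (hlam k) hϱ]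
    exact (hΘ k _ hk.1 _ hk.2).2.2.2
  -- (iv) the weak-`L³` slices (4.7)
  have hslice' : ∀ a : ℝ, 0 < a → ∀ᶠ k in atTop, ∀ s ∈ Ioo (-a ^ 2) (0 : ℝ), ∀ t : ℝ, 0 < t →
      ENNReal.ofReal (t ^ 3) *
        (volume.restrict (ball (0 : EuclideanSpace ℝ (Fin 3)) a)) {y | t < ‖v k s y‖} ≤
        ENNReal.ofReal (M ^ 3) := by
    intro a ha
    filter_upwards [hev a] with k hk s hs t ht
    rw [hv]
    have hRk := hR k
    refine zoom_weakL3_slice (hlam k) ha ?_ (hsl k) hs ht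
    calc lam k * a ≤ δ k * R k / 2 * a := by gcongr; exact hlamR k
      _ = R k * (δ k * a) / 2 := by ring
      _ ≤ R k * (1 / 2) / 2 := by gcongr
      _ ≤ R k := by linarith
  -- (v) the top pairings are small: (4.8) + weak continuity + (4.9)–(4.10)
  have htop' : ∀ φ : EuclideanSpace ℝ (Fin 3) → EuclideanSpace ℝ (Fin 3), ContDiff ℝ (⊤ : ℕ∞) φ →
      HasCompactSupport φ → ∀ ε : ℝ, 0 < ε → ∃ s₁ : ℝ, s₁ < 0 ∧ ∀ᶠ k in atTop,
        ∀ᵐ s ∂(volume.restrict (Ioo s₁ 0)), |∫ y, ⟪v k s y, φ y⟫| ≤ ε := by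
    intro φ hφ hφc ε hε
    obtain ⟨ρ₀, hρ₀, hφρ⟩ := hφc.isCompact.isBounded.subset_ball_lt 0 (0 : EuclideanSpace ℝ (Fin 3))
    obtain ⟨Θ₀, hΘ₀⟩ := hφ.continuous.bounded_above_of_compact_support hφc
    obtain ⟨A, B, hA, hB, Hmod⟩ := exists_uniform_pairing_modulus M K hφ hφc hρ₀ hφρ
    have hΘ₀nn : 0 ≤ Θ₀ := (norm_nonneg _).trans (hΘ₀ 0)
    have hM'nn : 0 ≤ (ENNReal.ofReal (M ^ 3)).toReal := ENNReal.toReal_nonneg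
    have hΦnn : 0 ≤ ∫ y, ‖φ y‖ := integral_nonneg fun _ => norm_nonneg _
    -- the free parameter of the layer-cake split
    have hL : Tendsto (fun L : ℝ => Θ₀ * (1 / 2 * L⁻¹ ^ 2 * (ENNReal.ofReal (M ^ 3)).toReal))
        atTop (𝓝 0) := by
      have h0 : Tendsto (fun L : ℝ => L⁻¹) atTop (𝓝 0) := tendsto_inv_atTop_zero
      have h := ((h0.pow 2).const_mul (1 / 2 : ℝ)).mul_const (ENNReal.ofReal (M ^ 3)).toReal
      have h3 := h.const_mul Θ₀
      simpa using h3
    obtain ⟨L₀, hL₀1, hL₀⟩ := ((eventually_ge_atTop (1 : ℝ)).and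
      (hL.eventually_le_const (by positivity : (0 : ℝ) < ε / 8))).exists
    have hL₀pos : 0 < L₀ := by linarith
    -- the time threshold
    have hs : Tendsto (fun s : ℝ => A * |s| + B * |s| ^ (1 / 3 : ℝ)) (𝓝[<] 0) (𝓝 0) := by
      have hc : Continuous (fun s : ℝ => A * |s| + B * |s| ^ (1 / 3 : ℝ)) :=
        (continuous_const.mul continuous_abs).add
          (continuous_const.mul (continuous_abs.rpow_const fun _ => Or.inr (by norm_num)))
      have h := hc.tendsto 0
      simp only [abs_zero, Real.zero_rpow (by norm_num : (1 / 3 : ℝ) ≠ 0), mul_zero,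
        add_zero] at h
      exact h.mono_left nhdsWithin_le_nhds
    have hneg0 : -ρ₀ ^ 2 < (0 : ℝ) := by
      have := pow_pos hρ₀ 2
      linarith
    obtain ⟨s₁, hs₁I, hs₁⟩ := (Filter.Eventually.and
      (show ∀ᶠ s in 𝓝[<] (0 : ℝ), s ∈ Ioo (-ρ₀ ^ 2) 0 from Ioo_mem_nhdsLT hneg0)
      (hs.eventually_le_const (by positivity : (0 : ℝ) < ε / 4))).exists
    refine ⟨s₁, hs₁I.2, ?_⟩
    -- the conditions on `k`
    have hk1 : ∀ᶠ k in atTop, Θ₀ * (δ k * L₀) ≤ ε / 8 := by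
      have h : Tendsto (fun k => Θ₀ * (δ k * L₀)) atTop (𝓝 0) := by
        simpa using (hδlim.mul_const L₀).const_mul Θ₀
      exact h.eventually_le_const (by positivity)
    have hk2 : ∀ᶠ k in atTop, δ k ^ 5 * ∫ y, ‖φ y‖ ≤ ε / 8 := by
      have h : Tendsto (fun k => δ k ^ 5 * ∫ y, ‖φ y‖) atTop (𝓝 0) := by
        simpa using (hδlim.pow 5).mul_const (∫ y, ‖φ y‖)
      exact h.eventually_le_const (by positivity)
    filter_upwards [hev ρ₀, hk1, hk2] with k hkρ hk1 hk2
    have hRk := hR k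
    have hlk := hlam k
    have hδk := hδpos k
    have hLk : 0 < R k / lam k := div_pos hRk hlk
    have hρ₀L : ρ₀ ≤ R k / lam k := by
      have h1 : ρ₀ ≤ 2 / δ k := by
        rw [le_div_iff₀ hδk]; nlinarith
      exact h1.trans (hRl k)
    have hρ₀r : ρ₀ ≤ r k / lam k := by
      rw [hrl k, le_div_iff₀ hδk]; nlinarith
    have hlamρ : lam k * ρ₀ ∈ Ioc (0 : ℝ) (R k / 4) := by
      refine ⟨mul_pos hlk hρ₀, ?_⟩
      calc lam k * ρ₀ ≤ δ k * R k / 2 * ρ₀ := by gcongr; exact hlamR k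
        _ = R k * (δ k * ρ₀) / 2 := by ring
        _ ≤ R k * (1 / 2) / 2 := by gcongr
        _ = R k / 4 := by ring
    have hsliceL : ∀ s ∈ Ioo (-(R k / lam k) ^ 2) (0 : ℝ), ∀ t : ℝ, 0 < t →
        ENNReal.ofReal (t ^ 3) *
          (volume.restrict (ball (0 : EuclideanSpace ℝ (Fin 3)) (R k / lam k))) {y | t < ‖v k s y‖} ≤
          ENNReal.ofReal (M ^ 3) := by
      intro s hs' t ht
      rw [hv]
      exact zoom_weakL3_slice (hlam k) hLk
        (le_of_eq (by rw [mul_div_assoc', mul_div_cancel_left₀ _ hlk.ne'])) (hsl k) hs' ht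
    have hDk : cknD ρ₀ (0 : ℝ × EuclideanSpace ℝ (Fin 3)) (q k) ≤ K := by
      rw [hq, cknD_zoom_zero (hlam k) hρ₀]; exact hD0 k _ hlamρ
    obtain ⟨S, hS, hmodS⟩ := Hmod (v k) (q k) (R k / lam k) hρ₀L (hballL k) hsliceL hDk
    have hS'ae : ∀ᵐ s ∂(volume.restrict (Ioo (-ρ₀ ^ 2) 0)), s ∈ S ∩ Ioo (-ρ₀ ^ 2) 0 := by
      filter_upwards [hS, ae_restrict_mem measurableSet_Ioo] with s h1 h2
      exact ⟨h1, h2⟩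
    have hmodS' : ∀ s ∈ S ∩ Ioo (-ρ₀ ^ 2) 0, ∀ s' ∈ S ∩ Ioo (-ρ₀ ^ 2) 0,
        |(∫ y, ⟪v k s y, φ y⟫) - ∫ y, ⟪v k s' y, φ y⟫| ≤ A * |s - s'| + B * |s - s'| ^ (1 / 3 : ℝ) :=
      fun s hs s' hs' => hmodS s hs.1 s' hs'.1
    have hcontL : ∀ w : EuclideanSpace ℝ (Fin 3) → EuclideanSpace ℝ (Fin 3), MemLp w 2 volume →
        support w ⊆ ball (0 : EuclideanSpace ℝ (Fin 3)) (R k / lam k) →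
        Tendsto (fun s => ∫ y, ⟪v k s y, w y⟫) (𝓝[<] 0) (𝓝 (∫ y, ⟪v k 0 y, w y⟫)) := by
      rw [hv]; exact zoom_weakContinuous_top (hlam k) (hcont k)
    have hm_eq : δ k ^ 4 * r k ^ 3 / lam k ^ 3 = δ k := by
      rw [hlamdef, div_eq_iff (pow_ne_zero 3 (mul_ne_zero hδk.ne' (hr k).ne'))]; ring
    have hτ_eq : lam k * δ k ^ 4 / r k = δ k ^ 5 := by
      rw [hlamdef, div_eq_iff (hr k).ne']; ring
    have hsparse : (volume.restrict (ball (0 : EuclideanSpace ℝ (Fin 3)) (r k / lam k)))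
        {y | δ k ^ 5 < ‖v k 0 y‖} ≤ ENNReal.ofReal (δ k) := by
      have h := zoom_sparse_top (z₀ := z₀ k) (hlam k) (hr k) (hsp k)
      rw [hm_eq, hτ_eq, ← hv] at h
      exact h
    have hϱL : r k / lam k ≤ R k / lam k := by
      have h : r k ≤ R k := by linarith [hrR k]
      gcongr
    have htop := abs_top_pairing_le (M := M) hLk (hballL k) hsliceL hcontL hϱL
      (by positivity : (0 : ℝ) ≤ δ k ^ 5) hδk.le hsparse hφ hφc (hφρ.trans (ball_subset_ball hρ₀r))
      hΘ₀ hρ₀ hS'ae hmodS' (fun s hs => hs.2) hL₀pos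
    have hsub1 : Ioo s₁ 0 ⊆ Ioo (-ρ₀ ^ 2) 0 := Ioo_subset_Ioo hs₁I.1.le le_rfl
    filter_upwards [ae_restrict_of_ae_restrict_of_subset hsub1 hS'ae,
      ae_restrict_mem measurableSet_Ioo] with s hsS hsI
    have h1 := htop s hsS
    have hss : |s| ≤ |s₁| := by
      rw [abs_of_neg hsI.2, abs_of_neg hs₁I.2]; linarith [hsI.1]
    have h2 : A * |s| + B * |s| ^ (1 / 3 : ℝ) ≤ A * |s₁| + B * |s₁| ^ (1 / 3 : ℝ) :=
      add_le_add (mul_le_mul_of_nonneg_left hss hA)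
        (mul_le_mul_of_nonneg_left (Real.rpow_le_rpow (abs_nonneg _) hss (by norm_num)) hB)
    have h3 : Θ₀ * (δ k * L₀ + 1 / 2 * L₀⁻¹ ^ 2 * (ENNReal.ofReal (M ^ 3)).toReal) =
        Θ₀ * (δ k * L₀) + Θ₀ * (1 / 2 * L₀⁻¹ ^ 2 * (ENNReal.ofReal (M ^ 3)).toReal) := by ring
    linarith
  -- (vi) non-smallness at the unit scale: Prop. 4.1 / (4.4) at `ϱ = λ_k ≥ ε_k r_k / ϑ`
  obtain ⟨κ, ϑ, hκ, hϑ, -, Hnon⟩ := le_cknC_of_unbounded K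
  have hnon' : ∀ᶠ k in atTop, ENNReal.ofReal κ ≤ cknC 1 0 (v k) := by
    filter_upwards [hevle ϑ hϑ] with k hk
    rw [hv, cknC_zoom_zero (hlam k) one_pos, mul_one]
    have hRk := hR k
    have hR4 : 0 < R k / 4 := by positivity
    have hsubQ : parabolicCylinder (R k / 4) (z₀ k) ⊆
        ((parabolicCylinderOpens (R k) (z₀ k) : Opens (ℝ × EuclideanSpace ℝ (Fin 3))) :
          Set (ℝ × EuclideanSpace ℝ (Fin 3))) := by
      rw [coe_parabolicCylinderOpens]
      exact parabolicCylinder_mono hR4.le (by linarith) _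
    have hΘ4 := hΘ k _ (hself k) (R k / 4) ⟨hR4, le_rfl⟩
    have hA : cknAEss (R k / 4) (z₀ k) (u k) ≠ ∞ := ne_top_of_le_ne_top ENNReal.coe_ne_top hΘ4.1
    have hE : cknE (R k / 4) (z₀ k) (G k) ≠ ∞ := ne_top_of_le_ne_top ENNReal.coe_ne_top hΘ4.2.1
    refine Hnon _ (u k) (pt k) (G k) (hballt k).1 (hG k) (z₀ k) (R k / 4) hR4 hsubQ hA hE (hD0 k)
      (δ k ^ 4 * r k) (mul_pos (pow_pos (hδpos k) 4) (hr k)) (hunb k) (lam k) ⟨hlam k, hlam4 k⟩ ?_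
    have hδ3 : δ k ^ 3 ≤ ϑ := (pow_le_of_le_one (hδpos k).le (hδ1 k) (by norm_num)).trans hk
    have hrk := (hr k).le
    have hδk := (hδpos k).le
    rw [hlamdef]
    calc δ k ^ 4 * r k = δ k ^ 3 * (δ k * r k) := by ring
      _ ≤ ϑ * (δ k * r k) := by gcongr
  -- ## the contradiction
  exact false_of_blowupSequence hball' hbd' hC' hD' hslice' htop' hκ hnon'

end Seregin2019

/-- **Seregin 2019, Proposition 1.4** (`Literature.Analysis.FluidPDE.seregin2019_localWeakL3_epsRegularity`)
**holds**: for all `M, N` there is `ε(M,N) ∈ (0, 1/4)` such that a suitable weak solution in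
`Q(z₀,R)` with a weak gradient of `D₀ + E ≤ N`, weak-`L³` slices of level `M`, slices weakly left-continuous at `t₀`,
and a sparse top slice `|{x ∈ B(x₀,r) : |v(x,t₀)| > ε/r}| ≤ ε r³` (`0 < r ≤ R/2`) is essentially
bounded in `Q(z₀, εr)`. Proof: negation with `ε_k = 16^{-(k+1)}` and
`Seregin2019.false_of_violators`. [cite: Seregin2019, Prop. 1.4 (arXiv:1906.06707 §1 p. 3, proof §4)] -/
theorem seregin2019_localWeakL3_epsRegularity_holds : seregin2019_localWeakL3_epsRegularity := by
  unfold seregin2019_localWeakL3_epsRegularity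
  intro M N
  by_contra hneg
  push Not at hneg
  have hk : ∀ k : ℕ, ∃ (z₀ : ℝ × EuclideanSpace ℝ (Fin 3)) (R : ℝ)
      (u : ℝ → EuclideanSpace ℝ (Fin 3) → EuclideanSpace ℝ (Fin 3))
      (p : ℝ → EuclideanSpace ℝ (Fin 3) → ℝ)
      (G : ℝ → EuclideanSpace ℝ (Fin 3) → EuclideanSpace ℝ (Fin 3) →L[ℝ] EuclideanSpace ℝ (Fin 3))
      (r : ℝ), 0 < R ∧
      IsSuitableWeakSolutionInBall R z₀ u p ∧
      HasWeakSpatialGradientOn (parabolicCylinderOpens R z₀) u G ∧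
      cknDOsc R z₀ p + cknE R z₀ G ≤ ENNReal.ofReal N ∧
      (∀ t ∈ Ioo (z₀.1 - R ^ 2) z₀.1, ∀ α : ℝ, 0 < α →
        ENNReal.ofReal (α ^ 3) *
            (volume.restrict (ball z₀.2 R)) {x : EuclideanSpace ℝ (Fin 3) | α < ‖u t x‖} ≤
          ENNReal.ofReal (M ^ 3)) ∧
      (∀ w : EuclideanSpace ℝ (Fin 3) → EuclideanSpace ℝ (Fin 3), MemLp w 2 volume →
        support w ⊆ ball z₀.2 R →
        Tendsto (fun t => ∫ x, ⟪u t x, w x⟫) (𝓝[<] z₀.1) (𝓝 (∫ x, ⟪u z₀.1 x, w x⟫))) ∧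
      0 < r ∧ r ≤ R / 2 ∧
      (volume.restrict (ball z₀.2 r))
          {x : EuclideanSpace ℝ (Fin 3) | ((1 / 2 : ℝ) ^ (k + 1)) ^ 4 / r < ‖u z₀.1 x‖} ≤
        ENNReal.ofReal (((1 / 2 : ℝ) ^ (k + 1)) ^ 4 * r ^ 3) ∧
      eLpNorm (uncurry u) ∞
        (volume.restrict (parabolicCylinder (((1 / 2 : ℝ) ^ (k + 1)) ^ 4 * r) z₀)) = ∞ := by
    intro k
    have hεpos : (0 : ℝ) < ((1 / 2 : ℝ) ^ (k + 1)) ^ 4 := by positivity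
    have hεlt : ((1 / 2 : ℝ) ^ (k + 1)) ^ 4 < 1 / 4 := by
      have h1 : (1 / 2 : ℝ) ^ (k + 1) ≤ (1 / 2 : ℝ) ^ 1 :=
        pow_le_pow_of_le_one (by norm_num) (by norm_num) (by omega)
      have h2 : ((1 / 2 : ℝ) ^ (k + 1)) ^ 4 ≤ ((1 / 2 : ℝ) ^ 1) ^ 4 :=
        pow_le_pow_left₀ (by positivity) h1 4
      exact h2.trans_lt (by norm_num)
    obtain ⟨z₀, R, hR, u, p, h1, G, hG, h2, h3, h4, r, hr, hrR, h5, h6⟩ := hneg _ hεpos hεlt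
    exact ⟨z₀, R, u, p, G, r, hR, h1, hG, h2, h3, h4, hr, hrR, h5, top_le_iff.1 h6⟩
  choose z₀ R u p G r hR hball hG hN hsl hcont hr hrR hsp hunb using hk
  exact Seregin2019.false_of_violators (δ := fun k => (1 / 2 : ℝ) ^ (k + 1)) (fun _ => rfl)
    hR hball hG hN hsl hcont hr hrR hsp hunb

end Literature.Analysis.FluidPDE

end
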